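import Mathlib
import Literature.NumberTheory.Transcendental.GammaFields
import Summits.Schanuel.Schanuel.Theorems.RigidCoreAclSubsetLogFreeCoreCaseIIShift
import Summits.Schanuel.Schanuel.Theorems.RigidCoreAclSubsetLogFreeCoreCaseIISemiInv
import Summits.Schanuel.Schanuel.Theorems.RigidCoreAclSubsetLogFreeCoreCaseIILaurent

/-!
# Case II core, file 7: the engine of one level — semi-invariant and fixed elements of `K = k(exp Y'')`
(helper file for the registered stub `stub_caseII_core` of line `eac-extends-core-automorphisms`,
crux stmt-Schanuel-0968 `Summit.Schanuel.Schanuel.Theses.RigidCore.AclSubsetLogFreeCore`)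

Same abstract one-level setting as files 4–6 (`…CaseIIMonomials`, `…CaseIISemiInv`,
`…CaseIILaurent`): a subfield `k`, subspaces `Y' ≤ Y''` with `exp Y' ⊆ k`, a basis `b` of `Y''`
modulo `Y'` whose level coordinates `exp (bᵢ / N)` are algebraically independent over `k`, and an
exponential automorphism `θ` stabilising `k`, `Y'`, `Y''`.  Two further inputs enter as hypotheses
(they are the registered stubs `stub_caseII_fractions` / `stub_caseII_denominator` of the line):
(Frac) every element of `K = k(exp Y'')` is a fraction `P(t)/Q(t)` in lowest terms, and
(Den) the denominator of a semi-invariant fraction in lowest terms is semi-invariant.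

* `support_subsingleton_of_semiInvariant` — under (Mono) a semi-invariant polynomial value
  `θ (F(t)) = (c · exp y) F(t)` has at most one monomial (file 5 applied to the exponential sum
  `F(t) = Σ_α F_α exp y_α`).
* **`exists_eq_const_mul_exp_of_semiInvariant`** (SemiF) — under (Mono), every non-zero
  semi-invariant `z ∈ K` is a monomial `c · exp y` (`c ∈ k`, `y ∈ Y''`).
* **`mem_of_fixed`** (FixF) — under (Mono), every `θ`-fixed `z ∈ K` lies in `k`.
* **`mono1_of_rep_of_fix`** — (Mono) at `n = 1` from (Rep) "semi-invariant constants are periodic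
  constants times `exp Y'`", the transversality (Log) and (FixIter) "iterates fix nothing new".
-/

noncomputable section

set_option linter.dupNamespace false

open Set
open scoped BigOperators
open Literature.ModelTheory.ExponentialFields Literature.ModelTheory.ExponentialFields.ExponentialRing
open Literature.NumberTheory.Transcendental Literature.NumberTheory.Transcendental.GammaField

namespace Summit.Schanuel.Schanuel.Theorems.RigidCore

namespace CaseIICore

variable {E : Type*} [Field E] [CharZero E] [ExponentialRing E]

/-! ### Semi-invariant polynomial values have a single monomial -/

open Classical in
/-- **Semi-invariant polynomial values are monomials, support form.**  Under (Mono), if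
`θ (F(t)) = (c · exp y₀) · F(t)` with `c ∈ kˣ`, `y₀ ∈ Y''`, then the support of `F` has at most one
element. [folklore] -/
theorem support_subsingleton_of_semiInvariant (k : Subfield E) {Y' Y'' : Submodule ℚ E} {p : ℕ}
    (b : Fin p → E)
    (hbspan : ∀ y ∈ Y'', ∃ r : Fin p → ℚ, y - ∑ i, r i • b i ∈ Y')
    (hblin : ∀ r : Fin p → ℚ, (∑ i, r i • b i) ∈ Y' → r = 0) (hbY : ∀ i, b i ∈ Y'')
    (hexpY' : ∀ y ∈ Y', exp y ∈ k)
    (hAI : ∀ N : ℕ, 0 < N → AlgebraicIndependent k (fun i => exp ((1 / (N : ℚ)) • b i)))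
    (θ : E ≃+* E) (hθexp : ∀ x, θ (exp x) = exp (θ x))
    (hθk : ∀ z, z ∈ k ↔ θ z ∈ k) (hθY' : ∀ y, y ∈ Y' ↔ θ y ∈ Y') (hθY'' : ∀ y, y ∈ Y'' ↔ θ y ∈ Y'')
    (hMono : ∀ n : ℕ, 0 < n → ∀ c ∈ k, c ≠ 0 → ∀ y ∈ Y'', y ∉ Y' → θ^[n] (c * exp y) ≠ c * exp y)
    {N : ℕ} (hN : 0 < N) {F : MvPolynomial (Fin p) k}
    {c y₀ : E} (hc : c ∈ k) (hc0 : c ≠ 0) (hy₀ : y₀ ∈ Y'')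
    (hsemi : θ (MvPolynomial.aeval (fun i => exp ((1 / (N : ℚ)) • b i)) F) =
      (c * exp y₀) * MvPolynomial.aeval (fun i => exp ((1 / (N : ℚ)) • b i)) F) :
    ∀ α ∈ F.support, ∀ β ∈ F.support, α = β := by
  -- the exponential sum over the support, indexed by the subtype
  set ι := {α // α ∈ F.support} with hι
  set y : ι → E := fun j => ∑ i, ((((j : Fin p →₀ ℕ) i : ℕ) : ℚ) / N) • b i with hy
  set q : ι → E := fun j => ((F.coeff (j : Fin p →₀ ℕ) : k) : E) with hq
  have hyY : ∀ j, y j ∈ Y'' := fun j => expnt_mem b hbY N _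
  have hineq : ∀ j₁ j₂ : ι, j₁ ≠ j₂ → y j₁ - y j₂ ∉ Y' := fun j₁ j₂ hne =>
    expnt_sub_expnt_not_mem b hblin hN fun h => hne (Subtype.ext h)
  have hqk : ∀ j, q j ∈ k := fun j => (F.coeff _).2
  have hq0 : ∀ j, q j ≠ 0 := fun j => by
    have := MvPolynomial.mem_support_iff.1 j.2
    exact fun h => this (Subtype.ext (by simpa [hq] using h))
  have hsum : MvPolynomial.aeval (fun i => exp ((1 / (N : ℚ)) • b i)) F = ∑ j : ι, q j * exp (y j) := by
    rw [aeval_eq_sum_exp k b N F, ← Finset.sum_coe_sort]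
  have hsemi' : θ (∑ j : ι, q j * exp (y j)) = (c * exp y₀) * ∑ j : ι, q j * exp (y j) := by
    rw [← hsum]; exact hsemi
  have hall := subsingleton_of_semiInvariant k b hbspan hblin hexpY' hAI θ hθexp hθk hθY' hθY'' hMono
    y hyY hineq q hqk hq0 hc hc0 hy₀ hsemi'
  intro α hα β hβ
  have := hall ⟨α, hα⟩ ⟨β, hβ⟩
  exact congrArg Subtype.val this

omit [CharZero E] [ExponentialRing E] in
/-- A non-zero polynomial whose support has at most one element is a monomial with a non-zero
coefficient. [folklore] -/
theorem eq_monomial_of_support_subsingleton {k : Subfield E} {p : ℕ} {F : MvPolynomial (Fin p) k}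
    (hF : F ≠ 0) (hsub : ∀ α ∈ F.support, ∀ β ∈ F.support, α = β) :
    ∃ α : Fin p →₀ ℕ, F.coeff α ≠ 0 ∧ F = MvPolynomial.monomial α (F.coeff α) := by
  classical
  obtain ⟨α, hα⟩ := MvPolynomial.ne_zero_iff.1 hF
  have hαs : α ∈ F.support := MvPolynomial.mem_support_iff.2 hα
  refine ⟨α, hα, MvPolynomial.ext _ _ fun β => ?_⟩
  rw [MvPolynomial.coeff_monomial]
  split_ifs with h
  · rw [h]
  · by_contra hβ
    exact h (hsub α hαs β (MvPolynomial.mem_support_iff.2 hβ))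

/-! ### (SemiF): semi-invariant elements of `K` are monomials -/

/-- **(SemiF) Semi-invariant elements of `K = k(exp Y'')` are monomials**, under (Mono), (Frac) and
(Den): if `z ∈ K`, `z ≠ 0` and `θ z = (c₀ · exp y₀) · z` with `c₀ ∈ kˣ`, `y₀ ∈ Y''`, then
`z = c · exp y` with `c ∈ k`, `y ∈ Y''`.  (Write `z = P(t)/Q(t)` in lowest terms; by (Den) the
denominator is semi-invariant, so it is a single monomial; then `P(t) = z Q(t)` is semi-invariant as
well, so `P` is a single monomial too.) [folklore] -/
theorem exists_eq_const_mul_exp_of_semiInvariant (k : Subfield E) {Y' Y'' : Submodule ℚ E} {p : ℕ}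
    (b : Fin p → E)
    (hbspan : ∀ y ∈ Y'', ∃ r : Fin p → ℚ, y - ∑ i, r i • b i ∈ Y')
    (hblin : ∀ r : Fin p → ℚ, (∑ i, r i • b i) ∈ Y' → r = 0) (hbY : ∀ i, b i ∈ Y'')
    (hexpY' : ∀ y ∈ Y', exp y ∈ k)
    (hAI : ∀ N : ℕ, 0 < N → AlgebraicIndependent k (fun i => exp ((1 / (N : ℚ)) • b i)))
    (θ : E ≃+* E) (hθexp : ∀ x, θ (exp x) = exp (θ x))
    (hθk : ∀ z, z ∈ k ↔ θ z ∈ k) (hθY' : ∀ y, y ∈ Y' ↔ θ y ∈ Y') (hθY'' : ∀ y, y ∈ Y'' ↔ θ y ∈ Y'')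
    (hFrac : ∀ z ∈ Subfield.closure ((k : Set E) ∪ exp '' (Y'' : Set E)),
      ∃ N : ℕ, 0 < N ∧ ∃ (P Q : MvPolynomial (Fin p) k), IsRelPrime P Q ∧
        MvPolynomial.aeval (fun i => exp ((1 / (N : ℚ)) • b i)) Q ≠ 0 ∧
        z * MvPolynomial.aeval (fun i => exp ((1 / (N : ℚ)) • b i)) Q =
          MvPolynomial.aeval (fun i => exp ((1 / (N : ℚ)) • b i)) P)
    (hDen : ∀ {N : ℕ}, 0 < N → ∀ {z : E} {P Q : MvPolynomial (Fin p) k}, IsRelPrime P Q →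
      MvPolynomial.aeval (fun i => exp ((1 / (N : ℚ)) • b i)) Q ≠ 0 →
      z * MvPolynomial.aeval (fun i => exp ((1 / (N : ℚ)) • b i)) Q =
        MvPolynomial.aeval (fun i => exp ((1 / (N : ℚ)) • b i)) P →
      ∀ {c₀ y₀ : E}, c₀ ∈ k → c₀ ≠ 0 → y₀ ∈ Y'' → θ z = (c₀ * exp y₀) * z →
      ∃ c ∈ k, c ≠ 0 ∧ ∃ y ∈ Y'',
        θ (MvPolynomial.aeval (fun i => exp ((1 / (N : ℚ)) • b i)) Q) =
          (c * exp y) * MvPolynomial.aeval (fun i => exp ((1 / (N : ℚ)) • b i)) Q)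
    (hMono : ∀ n : ℕ, 0 < n → ∀ c ∈ k, c ≠ 0 → ∀ y ∈ Y'', y ∉ Y' → θ^[n] (c * exp y) ≠ c * exp y)
    {z : E} (hzK : z ∈ Subfield.closure ((k : Set E) ∪ exp '' (Y'' : Set E))) (hz0 : z ≠ 0)
    {c₀ y₀ : E} (hc₀ : c₀ ∈ k) (hc₀0 : c₀ ≠ 0) (hy₀ : y₀ ∈ Y'') (hsemi : θ z = (c₀ * exp y₀) * z) :
    ∃ c ∈ k, ∃ y ∈ Y'', z = c * exp y := by
  classical
  obtain ⟨N, hN, P, Q, hrel, hQ, hzQ⟩ := hFrac z hzK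
  set t : Fin p → E := fun i => exp ((1 / (N : ℚ)) • b i) with ht
  -- the denominator is semi-invariant, hence a monomial
  obtain ⟨c, hc, hc0, y, hy, hQsemi⟩ := hDen hN hrel hQ hzQ hc₀ hc₀0 hy₀ hsemi
  have hQ0 : Q ≠ 0 := by rintro rfl; exact hQ (map_zero _)
  obtain ⟨M, hM, hQeq⟩ := eq_monomial_of_support_subsingleton hQ0
    (support_subsingleton_of_semiInvariant k b hbspan hblin hbY hexpY' hAI θ hθexp hθk hθY' hθY''
      hMono hN hc hc0 hy hQsemi)
  -- the numerator `P(t) = z Q(t)` is semi-invariant, hence a monomial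
  have hP0 : P ≠ 0 := by
    rintro rfl
    rw [map_zero] at hzQ
    exact (mul_ne_zero hz0 hQ) hzQ
  have hPsemi : θ (MvPolynomial.aeval t P) = ((c₀ * c) * exp (y₀ + y)) * MvPolynomial.aeval t P := by
    rw [← hzQ, map_mul, hsemi, hQsemi, exp_add]; ring
  obtain ⟨A, hA, hPeq⟩ := eq_monomial_of_support_subsingleton hP0
    (support_subsingleton_of_semiInvariant k b hbspan hblin hbY hexpY' hAI θ hθexp hθk hθY' hθY''
      hMono hN (mul_mem hc₀ hc) (mul_ne_zero hc₀0 hc0) (Y''.add_mem hy₀ hy) hPsemi)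
  -- read off `z`
  set yM : E := ∑ i, (((M i : ℕ) : ℚ) / N) • b i with hyM
  set yA : E := ∑ i, (((A i : ℕ) : ℚ) / N) • b i with hyA
  have hQval : MvPolynomial.aeval t Q = ((Q.coeff M : k) : E) * exp yM := by
    conv_lhs => rw [hQeq]
    exact aeval_monomial_exp k b N M _
  have hPval : MvPolynomial.aeval t P = ((P.coeff A : k) : E) * exp yA := by
    conv_lhs => rw [hPeq]
    exact aeval_monomial_exp k b N A _
  have hqM0 : ((Q.coeff M : k) : E) ≠ 0 := fun h => hM (Subtype.ext h)
  refine ⟨((P.coeff A : k) : E) / ((Q.coeff M : k) : E), div_mem (P.coeff A).2 (Q.coeff M).2, yA - yM,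
    Y''.sub_mem (expnt_mem b hbY N A) (expnt_mem b hbY N M), ?_⟩
  have hz : z = MvPolynomial.aeval t P / MvPolynomial.aeval t Q := by
    rw [eq_div_iff hQ, hzQ]
  have h1 := exp_ne_zero yM
  rw [hz, hPval, hQval, sub_eq_add_neg, exp_add, exp_neg_eq_inv]
  field_simp

/-! ### (FixF): fixed elements of `K` lie in `k` -/

/-- **(FixF) Fixed elements of `K = k(exp Y'')` lie in `k`**, under (Mono), (Frac) and (Den): a
`θ`-fixed `z ∈ K` is `0` or a monomial `c · exp y` (SemiF with multiplier `1`), and a FIXED monomial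
has `y ∈ Y'` by (Mono) at `n = 1`, so that `exp y ∈ k`. [folklore] -/
theorem mem_of_fixed (k : Subfield E) {Y' Y'' : Submodule ℚ E} {p : ℕ} (b : Fin p → E)
    (hbspan : ∀ y ∈ Y'', ∃ r : Fin p → ℚ, y - ∑ i, r i • b i ∈ Y')
    (hblin : ∀ r : Fin p → ℚ, (∑ i, r i • b i) ∈ Y' → r = 0) (hbY : ∀ i, b i ∈ Y'')
    (hexpY' : ∀ y ∈ Y', exp y ∈ k)
    (hAI : ∀ N : ℕ, 0 < N → AlgebraicIndependent k (fun i => exp ((1 / (N : ℚ)) • b i)))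
    (θ : E ≃+* E) (hθexp : ∀ x, θ (exp x) = exp (θ x))
    (hθk : ∀ z, z ∈ k ↔ θ z ∈ k) (hθY' : ∀ y, y ∈ Y' ↔ θ y ∈ Y') (hθY'' : ∀ y, y ∈ Y'' ↔ θ y ∈ Y'')
    (hFrac : ∀ z ∈ Subfield.closure ((k : Set E) ∪ exp '' (Y'' : Set E)),
      ∃ N : ℕ, 0 < N ∧ ∃ (P Q : MvPolynomial (Fin p) k), IsRelPrime P Q ∧
        MvPolynomial.aeval (fun i => exp ((1 / (N : ℚ)) • b i)) Q ≠ 0 ∧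
        z * MvPolynomial.aeval (fun i => exp ((1 / (N : ℚ)) • b i)) Q =
          MvPolynomial.aeval (fun i => exp ((1 / (N : ℚ)) • b i)) P)
    (hDen : ∀ {N : ℕ}, 0 < N → ∀ {z : E} {P Q : MvPolynomial (Fin p) k}, IsRelPrime P Q →
      MvPolynomial.aeval (fun i => exp ((1 / (N : ℚ)) • b i)) Q ≠ 0 →
      z * MvPolynomial.aeval (fun i => exp ((1 / (N : ℚ)) • b i)) Q =
        MvPolynomial.aeval (fun i => exp ((1 / (N : ℚ)) • b i)) P →
      ∀ {c₀ y₀ : E}, c₀ ∈ k → c₀ ≠ 0 → y₀ ∈ Y'' → θ z = (c₀ * exp y₀) * z →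
      ∃ c ∈ k, c ≠ 0 ∧ ∃ y ∈ Y'',
        θ (MvPolynomial.aeval (fun i => exp ((1 / (N : ℚ)) • b i)) Q) =
          (c * exp y) * MvPolynomial.aeval (fun i => exp ((1 / (N : ℚ)) • b i)) Q)
    (hMono : ∀ n : ℕ, 0 < n → ∀ c ∈ k, c ≠ 0 → ∀ y ∈ Y'', y ∉ Y' → θ^[n] (c * exp y) ≠ c * exp y)
    {z : E} (hzK : z ∈ Subfield.closure ((k : Set E) ∪ exp '' (Y'' : Set E))) (hfix : θ z = z) :
    z ∈ k := by
  by_cases hz0 : z = 0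
  · rw [hz0]; exact k.zero_mem
  have hsemi : θ z = (1 * exp 0) * z := by rw [exp_zero, one_mul, one_mul, hfix]
  obtain ⟨c, hc, y, hy, hzeq⟩ := exists_eq_const_mul_exp_of_semiInvariant k b hbspan hblin hbY hexpY'
    hAI θ hθexp hθk hθY' hθY'' hFrac hDen hMono hzK hz0 k.one_mem one_ne_zero Y''.zero_mem hsemi
  have hc0 : c ≠ 0 := by rintro rfl; exact hz0 (by rw [hzeq, zero_mul])
  -- a fixed monomial has its exponent in `Y'`
  have hyY' : y ∈ Y' := by
    by_contra hyY'
    refine hMono 1 one_pos c hc hc0 y hy hyY' ?_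
    rw [Function.iterate_one, ← hzeq, hfix]
  rw [hzeq]
  exact mul_mem hc (hexpY' y hyY')

/-! ### (Mono) at `n = 1` from (Rep), (Log), (FixIter) -/

/-- **(Mono) at `n = 1`.**  Let `θ` stabilise `k` and `Y''`, fix `τ` and shift `ℓ ∈ Y'` by `q • τ`
(`q ≠ 0`), with kernel `exp z = 1 → z ∈ ℤτ`.  Assume (Rep): every `c ∈ kˣ` with `θ c = exp w · c`,
`w ∈ Y'`, is `c₀ · exp yₜ` with `yₜ ∈ Y'` and `c₀` periodic under `θ`; (Log): `w ∈ Y''`,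
`exp w ∈ k ⇒ w ∈ Y'`; (FixIter): an element of `Y''` fixed by a positive iterate of `θ` lies in `Y'`.
Then a fixed monomial `θ (c · exp y) = c · exp y` (`c ∈ kˣ`, `y ∈ Y''`) has `y ∈ Y'`.
Proof: `θ c = exp (y − θ y) · c` with `y − θ y ∈ Y'` by (Log); (Rep) gives `c = c₀ exp yₜ` with
`θ^[M] c₀ = c₀`; then `exp (θ^[M] u − u) = 1` for `u = y + yₜ`, so `θ^[M] u = u + m τ`, and
`u − (m / (M q)) • ℓ` is `θ^[M]`-fixed, hence in `Y'` by (FixIter). [folklore] -/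
theorem mono1_of_rep_of_fix (k : Subfield E) {Y' Y'' : Submodule ℚ E}
    (θ : E ≃+* E) (hθexp : ∀ x, θ (exp x) = exp (θ x))
    (hθk : ∀ z, z ∈ k ↔ θ z ∈ k) (hθY'' : ∀ y, y ∈ Y'' ↔ θ y ∈ Y'') (hY : Y' ≤ Y'')
    {τ : E} (hθτ : θ τ = τ) (hker : ∀ z, exp z = 1 → ∃ m : ℤ, z = (m : ℚ) • τ)
    {ℓ : E} (hℓ : ℓ ∈ Y') {q : ℚ} (hq : q ≠ 0) (hθℓ : θ ℓ = ℓ + q • τ)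
    (hRep : ∀ c ∈ k, c ≠ 0 → ∀ w ∈ Y', θ c = exp w * c →
      ∃ c₀ yt : E, yt ∈ Y' ∧ c = c₀ * exp yt ∧ ∃ M : ℕ, 0 < M ∧ θ^[M] c₀ = c₀)
    (hLog : ∀ w ∈ Y'', exp w ∈ k → w ∈ Y')
    (hFixIter : ∀ M : ℕ, 0 < M → ∀ u ∈ Y'', θ^[M] u = u → u ∈ Y') :
    ∀ c ∈ k, c ≠ 0 → ∀ y ∈ Y'', θ (c * exp y) = c * exp y → y ∈ Y' := by
  intro c hc hc0 y hy hfix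
  have hθsmul : ∀ (a : ℚ) (v : E), θ (a • v) = a • θ v := fun a v => map_rat_smul θ.toAddMonoidHom a v
  -- `θ c = exp w * c` with `w = y - θ y ∈ Y'`
  set w : E := y - θ y with hw
  have hwY'' : w ∈ Y'' := Y''.sub_mem hy ((hθY'' y).1 hy)
  have hθc : θ c = exp w * c := by
    rw [map_mul, hθexp] at hfix
    have h1 : θ c = c * exp y * (exp (θ y))⁻¹ := by
      rw [← hfix, mul_assoc, mul_inv_cancel₀ (exp_ne_zero _), mul_one]
    rw [h1, hw, sub_eq_add_neg, exp_add, exp_neg_eq_inv]; ring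
  have hexpw : exp w ∈ k := by
    have h1 : exp w = θ c * c⁻¹ := by rw [hθc, mul_assoc, mul_inv_cancel₀ hc0, mul_one]
    rw [h1]
    exact mul_mem ((hθk c).1 hc) (inv_mem hc)
  have hwY' : w ∈ Y' := hLog w hwY'' hexpw
  -- (Rep): `c = c₀ exp yt`, `θ^[M] c₀ = c₀`
  obtain ⟨c₀, yt, hyt, hceq, M, hM, hMc₀⟩ := hRep c hc hc0 w hwY' hθc
  have hc₀0 : c₀ ≠ 0 := by rintro rfl; exact hc0 (by rw [hceq, zero_mul])
  -- the iterate `ψ = θ^[M]`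
  obtain ⟨ψ, hψ, hψexp⟩ := exists_ringEquiv_iterate θ hθexp M
  set u : E := y + yt with hu
  have huY'' : u ∈ Y'' := Y''.add_mem hy (hY hyt)
  have hfix' : θ (c₀ * exp u) = c₀ * exp u := by
    have : c₀ * exp u = c * exp y := by rw [hceq, hu, exp_add]; ring
    rw [this, hfix]
  have hψfix : ψ (c₀ * exp u) = c₀ * exp u := by rw [hψ]; exact iterate_apply_eq_self θ hfix' M
  have hψc₀ : ψ c₀ = c₀ := by rw [hψ, hMc₀]
  -- `exp (ψ u - u) = 1`, so `ψ u = u + m τ`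
  have hexp1 : exp (ψ u - u) = 1 := by
    rw [map_mul, hψc₀, hψexp] at hψfix
    have h1 : exp (ψ u) = exp u := mul_left_cancel₀ hc₀0 hψfix
    rw [sub_eq_add_neg, exp_add, h1, exp_neg_eq_inv, mul_inv_cancel₀ (exp_ne_zero _)]
  obtain ⟨m, hm⟩ := hker _ hexp1
  have hψu : ψ u = u + (m : ℚ) • τ := by rw [← hm]; abel
  -- `ψ ℓ = ℓ + (M q) • τ`
  have hqτ : θ (q • τ) = q • τ := by rw [hθsmul, hθτ]
  have hψℓ : ψ ℓ = ℓ + ((M : ℚ) * q) • τ := by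
    rw [hψ, iterate_apply_branch θ hqτ hθℓ M, mul_smul, Nat.cast_smul_eq_nsmul, nsmul_eq_mul]
  have hψτ : ψ τ = τ := by rw [hψ]; exact iterate_apply_eq_self θ hθτ M
  have hψsmul : ∀ (a : ℚ) (v : E), ψ (a • v) = a • ψ v := fun a v => map_rat_smul ψ.toAddMonoidHom a v
  -- the corrected element `u' = u - (m / (M q)) • ℓ` is `ψ`-fixed
  have hMq : ((M : ℚ) * q) ≠ 0 := mul_ne_zero (by exact_mod_cast hM.ne') hq
  set u' : E := u - ((m : ℚ) / ((M : ℚ) * q)) • ℓ with hu'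
  have hu'Y'' : u' ∈ Y'' := Y''.sub_mem huY'' (Y''.smul_mem _ (hY hℓ))
  have hψu' : ψ u' = u' := by
    rw [hu', map_sub, hψsmul, hψu, hψℓ, smul_add, smul_smul, div_mul_cancel₀ _ hMq]
    abel
  have hu'fix : θ^[M] u' = u' := by rw [← hψ]; exact hψu'
  have hu'Y' : u' ∈ Y' := hFixIter M hM u' hu'Y'' hu'fix
  -- conclude
  have huY' : u ∈ Y' := by
    have : u = u' + ((m : ℚ) / ((M : ℚ) * q)) • ℓ := by rw [hu']; abel
    rw [this]
    exact Y'.add_mem hu'Y' (Y'.smul_mem _ hℓ)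
  have : y = u - yt := by rw [hu]; abel
  rw [this]
  exact Y'.sub_mem huY' hyt

end CaseIICore

/-! ### Registered helper (crux stub list of stmt-Schanuel-0968) -/

/-- **Registered form of `CaseIICore.mono1_of_rep_of_fix`** (all binders explicit): (Mono) at
`n = 1` from (Rep), (Log) and (FixIter). [folklore] -/
theorem caseII_mono1_of_rep_of_fix {E : Type*} [Field E] [CharZero E] [ExponentialRing E]
    (k : Subfield E) {Y' Y'' : Submodule ℚ E}
    (θ : E ≃+* E) (hθexp : ∀ x, θ (exp x) = exp (θ x))
    (hθk : ∀ z, z ∈ k ↔ θ z ∈ k) (hθY'' : ∀ y, y ∈ Y'' ↔ θ y ∈ Y'') (hY : Y' ≤ Y'')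
    {τ : E} (hθτ : θ τ = τ) (hker : ∀ z, exp z = 1 → ∃ m : ℤ, z = (m : ℚ) • τ)
    {ℓ : E} (hℓ : ℓ ∈ Y') {q : ℚ} (hq : q ≠ 0) (hθℓ : θ ℓ = ℓ + q • τ)
    (hRep : ∀ c ∈ k, c ≠ 0 → ∀ w ∈ Y', θ c = exp w * c →
      ∃ c₀ yt : E, yt ∈ Y' ∧ c = c₀ * exp yt ∧ ∃ M : ℕ, 0 < M ∧ θ^[M] c₀ = c₀)
    (hLog : ∀ w ∈ Y'', exp w ∈ k → w ∈ Y')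
    (hFixIter : ∀ M : ℕ, 0 < M → ∀ u ∈ Y'', θ^[M] u = u → u ∈ Y') :
    ∀ c ∈ k, c ≠ 0 → ∀ y ∈ Y'', θ (c * exp y) = c * exp y → y ∈ Y' :=
  CaseIICore.mono1_of_rep_of_fix k θ hθexp hθk hθY'' hY hθτ hker hℓ hq hθℓ hRep hLog hFixIter

end Summit.Schanuel.Schanuel.Theorems.RigidCore
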